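import Summits.CriticalPhenomena.PercolationContinuityZ3.Theorems.Transplant.FKConnectivityAllQFastEvalBridge
import Summits.CriticalPhenomena.PercolationContinuityZ3.Theorems.Transplant.FKConnectivityAllQHubCovFiberPoly
import HarnessLib

/-!
# The fast kernel evaluator, file 4: the mask bridge for a GENERAL fibre `(M, u₀)` of a listed graph (common open part `u₀ ≠ ∅`)

Support file (`--supports stmt-CriticalPhenomena-4575`), FK sub-lane `prim-bschramm-fk-1` (gen 17) of the post-continuity programme;
builds on p205010 (kernel theorem, internal audit signed; external expert review pending).  No definitions, no named facts, no sorries;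
standard axioms.

`…FastEvalBridge.lean` evaluates fibre counts on fibres `(conf (firstT d), ∅)` — full bipartitions of a listed graph.  The lineage's
nodes quantify over ALL fibres `(M, u₀)` (`Disjoint u₀ M`); a fibre with `u₀ ≠ ∅` realises a CONTRACTION minor (the common open pairs
`u₀` are contracted on both sides), i.e. a multigraph witness, which the `u₀ = ∅` bridge cannot express on a simple vertex type.  Here, for
a listed graph `D` and two masks `μ, υ` with no common bit (`M = conf (tOf μ)`, `u₀ = conf (tOf υ)`):
**`fibreCount_conf_tOf_eq_card`** — `fibreCount M u₀ A B` = the number of masks `a < 2^m` with `a ⊆ μ` (`a &&& μ = a`),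
`conf (tOf (υ ||| a)) ∈ A` and `conf (tOf (υ ||| (μ ^^^ a))) ∈ B` (the configuration `u₀ ∪ X`, `X ⊆ M`, and its flip `u₀ ∪ (M ∖ X)`);
Boolean form **`fibreCount_conf_tOf_eq_card_bool`**, ready for `card_filter_range_eq_sumR` / `three_counts_eq_sumR` and `decide +kernel`.
Tools: `tOf_lor`, `tOf_xor_of_land_eq`, `disjoint_tOf_of_land_eq_zero` (and fk-1 g6's `conf_union`), the fibre identities `union_sdiff_eq_of_fibre`,
`union_symmDiff_eq_of_fibre`.
[cite: Linusson2011, Prop. 2.6] [cite: Grimmett2006, §1.2 eq. (1.1) (p. 4)]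
-/

namespace Summit.CriticalPhenomena.PercolationContinuityZ3.Theorems

namespace FK

namespace RCEval

open Literature.Probability.LatticeModels Literature.Probability.Percolation
open scoped Classical symmDiff

variable {D : RCEval}

/-! ### Masks: union, relative complement, disjointness -/

/-- `tOf (x ||| y) = tOf x ∪ tOf y`. [folklore] -/
theorem tOf_lor (x y : ℕ) : D.tOf (Nat.lor x y) = D.tOf x ∪ D.tOf y := by
  ext i
  rw [Finset.mem_union, mem_tOf, mem_tOf, mem_tOf, Nat.lor_eq, Nat.testBit_or, Bool.or_eq_true]

/-- For `a ⊆ μ` (`a &&& μ = a`): `tOf (μ ^^^ a) = tOf μ ∖ tOf a`. [folklore] -/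
theorem tOf_xor_of_land_eq {μ a : ℕ} (ha : Nat.land a μ = a) : D.tOf (Nat.xor μ a) = D.tOf μ \ D.tOf a := by
  ext i
  rw [Finset.mem_sdiff, mem_tOf, mem_tOf, mem_tOf, Nat.xor_eq, Nat.testBit_xor]
  have hsub : a.testBit i.val = true → μ.testBit i.val = true := fun h => by
    have := congrArg (fun z => Nat.testBit z i.val) ha
    simp only [Nat.land_eq, Nat.testBit_and, h] at this
    simpa using this
  cases hμ : μ.testBit i.val <;> cases hai : a.testBit i.val <;> simp_all

/-- For `a ⊆ μ`: `tOf a ⊆ tOf μ`. [folklore] -/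
theorem tOf_subset_of_land_eq {μ a : ℕ} (ha : Nat.land a μ = a) : D.tOf a ⊆ D.tOf μ := by
  intro i hi
  rw [mem_tOf] at hi ⊢
  have := congrArg (fun z => Nat.testBit z i.val) ha
  simp only [Nat.land_eq, Nat.testBit_and, hi] at this
  simpa using this

/-- Masks without a common bit open disjoint index sets. [folklore] -/
theorem disjoint_tOf_of_land_eq_zero {μ υ : ℕ} (h : Nat.land μ υ = 0) : Disjoint (D.tOf μ) (D.tOf υ) := by
  rw [Finset.disjoint_left]
  intro i hμ hυ
  rw [mem_tOf] at hμ hυ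
  have := congrArg (fun z => Nat.testBit z i.val) h
  simp only [Nat.land_eq, Nat.testBit_and, hμ, hυ, Bool.and_self, Nat.zero_testBit] at this
  exact Bool.noConfusion this

/-- Disjoint index sets give disjoint configurations (valid data). [folklore] -/
theorem disjoint_conf (hD : D.Valid) {s t : Finset (Fin D.m)} (h : Disjoint s t) : Disjoint (D.conf s) (D.conf t) := by
  rw [Set.disjoint_left]
  intro g hs ht
  unfold conf at hs ht
  rw [Finset.mem_coe, Finset.mem_image] at hs ht
  obtain ⟨i, hi, rfl⟩ := hs
  obtain ⟨j, hj, hji⟩ := ht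
  exact Finset.disjoint_left.1 h hi (hD.1 hji ▸ hj)

/-! ### The two configurations of a mask on the fibre -/

/-- On the fibre `(M, u₀)` with `u₀ ∩ M = ∅`: `(u₀ ∪ X) ∖ M = u₀` for `X ⊆ M`. [folklore] -/
theorem union_sdiff_eq_of_fibre {M u₀ X : BondConfig (Fin D.n)} (hd : Disjoint u₀ M) (hX : X ⊆ M) : (u₀ ∪ X) \ M = u₀ := by
  ext g
  rw [Set.mem_sdiff, Set.mem_union]
  constructor
  · rintro ⟨hg | hg, hgM⟩
    · exact hg
    · exact absurd (hX hg) hgM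
  · intro hg; exact ⟨Or.inl hg, fun hgM => Set.disjoint_left.1 hd hg hgM⟩

/-- On the fibre: `(u₀ ∪ X) ∆ M = u₀ ∪ (M ∖ X)` for `X ⊆ M`. [folklore] -/
theorem union_symmDiff_eq_of_fibre {M u₀ X : BondConfig (Fin D.n)} (hd : Disjoint u₀ M) (hX : X ⊆ M) : (u₀ ∪ X) ∆ M = u₀ ∪ (M \ X) := by
  ext g
  rw [Set.mem_symmDiff, Set.mem_union, Set.mem_union, Set.mem_sdiff]
  constructor
  · rintro (⟨hg | hg, hgM⟩ | ⟨hgM, hg⟩)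
    · exact Or.inl hg
    · exact absurd (hX hg) hgM
    · rw [not_or] at hg; exact Or.inr ⟨hgM, hg.2⟩
  · rintro (hg | ⟨hgM, hgX⟩)
    · exact Or.inl ⟨Or.inl hg, fun hgM => Set.disjoint_left.1 hd hg hgM⟩
    · exact Or.inr ⟨hgM, fun h => h.elim (fun hu => Set.disjoint_left.1 hd hu hgM) hgX⟩

/-! ### The bridge -/

/-- **The mask bridge for a general fibre of a listed graph**: for masks `μ, υ` without a common bit,
`fibreCount (conf (tOf μ)) (conf (tOf υ)) A B` counts the masks `a < 2^m` with `a ⊆ μ`, `conf (tOf (υ ||| a)) ∈ A` and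
`conf (tOf (υ ||| (μ ^^^ a))) ∈ B`. [cite: Linusson2011, Prop. 2.6] -/
theorem fibreCount_conf_tOf_eq_card (hD : D.Valid) {μ υ : ℕ} (hdis : Nat.land μ υ = 0)
    (A B : Set (BondConfig (Fin D.n))) :
    fibreCount (D.conf (D.tOf μ)) (D.conf (D.tOf υ)) A B =
      ((Finset.range (2 ^ D.m)).filter fun a => Nat.land a μ = a ∧
        D.conf (D.tOf (Nat.lor υ a)) ∈ A ∧ D.conf (D.tOf (Nat.lor υ (Nat.xor μ a))) ∈ B).card := by
  have hdu : Disjoint (D.conf (D.tOf υ)) (D.conf (D.tOf μ)) :=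
    disjoint_conf hD (disjoint_tOf_of_land_eq_zero (by rw [Nat.land_eq, Nat.and_comm, ← Nat.land_eq]; exact hdis))
  -- the two configurations of a mask `a ⊆ μ`
  have hω : ∀ {a : ℕ}, Nat.land a μ = a → D.conf (D.tOf (Nat.lor υ a)) = D.conf (D.tOf υ) ∪ D.conf (D.tOf a) := fun _ => by
    rw [tOf_lor, conf_union]
  have hω' : ∀ {a : ℕ}, Nat.land a μ = a →
      D.conf (D.tOf (Nat.lor υ (Nat.xor μ a))) = D.conf (D.tOf υ) ∪ (D.conf (D.tOf μ) \ D.conf (D.tOf a)) := fun ha => by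
    rw [tOf_lor, conf_union, tOf_xor_of_land_eq ha, conf_sdiff hD]
  unfold fibreCount
  symm
  refine Finset.card_bij (fun a _ => D.conf (D.tOf (Nat.lor υ a))) (fun a ha => ?_) (fun a₁ ha₁ a₂ ha₂ h => ?_) (fun ω hωf => ?_)
  · rw [Finset.mem_filter] at ha
    obtain ⟨-, haμ, hA, hB⟩ := ha
    have hX : D.conf (D.tOf a) ⊆ D.conf (D.tOf μ) := conf_mono (tOf_subset_of_land_eq haμ)
    refine Finset.mem_filter.2 ⟨Finset.mem_univ _, ?_, hA, ?_⟩
    · rw [hω haμ]; exact union_sdiff_eq_of_fibre hdu hX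
    · rw [hω haμ, union_symmDiff_eq_of_fibre hdu hX, ← hω' haμ]; exact hB
  · rw [Finset.mem_filter, Finset.mem_range] at ha₁ ha₂
    have ht : D.tOf (Nat.lor υ a₁) = D.tOf (Nat.lor υ a₂) := conf_injective hD h
    refine Nat.eq_of_testBit_eq fun j => ?_
    by_cases hj : j < D.m
    · have h1 := mem_tOf (Nat.lor υ a₁) ⟨j, hj⟩
      have h2 := mem_tOf (Nat.lor υ a₂) ⟨j, hj⟩
      rw [ht] at h1
      have key : (Nat.lor υ a₁).testBit j = true ↔ (Nat.lor υ a₂).testBit j = true := h1.symm.trans h2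
      rw [Nat.lor_eq, Nat.lor_eq, Nat.testBit_or, Nat.testBit_or, Bool.or_eq_true, Bool.or_eq_true] at key
      -- bits of `a₁, a₂` inside `μ` are decided by `key` (`υ` vanishes there); outside `μ` both vanish
      have hsub1 := congrArg (fun z => Nat.testBit z j) ha₁.2.1
      have hsub2 := congrArg (fun z => Nat.testBit z j) ha₂.2.1
      have hυμ := congrArg (fun z => Nat.testBit z j) hdis
      simp only [Nat.land_eq, Nat.testBit_and, Nat.zero_testBit] at hsub1 hsub2 hυμ
      cases hμj : μ.testBit j <;> cases hυj : υ.testBit j <;> cases h1j : a₁.testBit j <;> cases h2j : a₂.testBit j <;> simp_all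
    · rw [not_lt] at hj
      have hle : 2 ^ D.m ≤ 2 ^ j := Nat.pow_le_pow_right (by norm_num) hj
      rw [Nat.testBit_lt_two_pow (lt_of_lt_of_le ha₁.1 hle), Nat.testBit_lt_two_pow (lt_of_lt_of_le ha₂.1 hle)]
  · rw [Finset.mem_filter] at hωf
    obtain ⟨-, hωM, hA, hB⟩ := hωf
    -- `ω = u₀ ∪ X` with `X ⊆ M`, all inside the listed pairs
    have hu : D.conf (D.tOf υ) ⊆ ω := by rw [← hωM]; exact Set.sdiff_subset
    have hωsub : ω ⊆ D.conf (D.tOf μ) ∪ D.conf (D.tOf υ) := by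
      intro g hg
      by_cases hgM : g ∈ D.conf (D.tOf μ)
      · exact Or.inl hgM
      · have : g ∈ ω \ D.conf (D.tOf μ) := ⟨hg, hgM⟩
        rw [hωM] at this; exact Or.inr this
    have hrange : ω ⊆ Set.range D.edge := fun g hg =>
      (hωsub hg).elim (fun h => conf_subset_range _ h) (fun h => conf_subset_range _ h)
    obtain ⟨t, rfl⟩ := exists_conf_eq_of_subset hrange
    have htυ : D.tOf υ ⊆ t := fun i hi => (edge_mem_conf hD t i).1 (hu ((edge_mem_conf hD _ i).2 hi))
    have htμυ : t ⊆ D.tOf μ ∪ D.tOf υ := fun i hi => by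
      rcases hωsub ((edge_mem_conf hD t i).2 hi) with h | h
      · exact Finset.mem_union_left _ ((edge_mem_conf hD _ i).1 h)
      · exact Finset.mem_union_right _ ((edge_mem_conf hD _ i).1 h)
    set a := D.maskOf (t \ D.tOf υ) with ha
    have hta : D.tOf a = t \ D.tOf υ := tOf_maskOf _
    have haμ : Nat.land a μ = a := by
      refine Nat.eq_of_testBit_eq fun j => ?_
      rw [Nat.land_eq, Nat.testBit_and]
      cases haj : a.testBit j
      · simp
      · obtain ⟨i, hi, rfl⟩ := (testBit_maskOf _ _).1 haj
        have hiμ : i ∈ D.tOf μ := by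
          rcases Finset.mem_union.1 (htμυ (Finset.mem_sdiff.1 hi).1) with h | h
          · exact h
          · exact absurd h (Finset.mem_sdiff.1 hi).2
        rw [mem_tOf] at hiμ; simp [hiμ]
    have halt : a < 2 ^ D.m := maskOf_lt (fun i _ => (mem_firstT D.m i).2 i.is_lt)
    have hteq : D.tOf (Nat.lor υ a) = t := by
      rw [tOf_lor, hta, Finset.union_sdiff_of_subset htυ]
    refine ⟨a, Finset.mem_filter.2 ⟨Finset.mem_range.2 halt, haμ, ?_, ?_⟩, by rw [hteq]⟩
    · rw [hteq]; exact hA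
    · have hX : D.conf (D.tOf a) ⊆ D.conf (D.tOf μ) := conf_mono (tOf_subset_of_land_eq haμ)
      rw [hω' haμ, ← union_symmDiff_eq_of_fibre hdu hX, ← hω haμ, hteq]; exact hB

/-- **General mask bridge, Boolean form.** [cite: Linusson2011, Prop. 2.6] -/
theorem fibreCount_conf_tOf_eq_card_bool (hD : D.Valid) {μ υ : ℕ} (hdis : Nat.land μ υ = 0)
    {A B : Set (BondConfig (Fin D.n))} (g : ℕ → Bool)
    (hg : ∀ a, a < 2 ^ D.m → ((Nat.land a μ = a ∧ D.conf (D.tOf (Nat.lor υ a)) ∈ A ∧ D.conf (D.tOf (Nat.lor υ (Nat.xor μ a))) ∈ B) ↔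
      g a = true)) :
    fibreCount (D.conf (D.tOf μ)) (D.conf (D.tOf υ)) A B = ((Finset.range (2 ^ D.m)).filter fun a => g a = true).card := by
  rw [fibreCount_conf_tOf_eq_card hD hdis]
  congr 1
  exact Finset.filter_congr fun a ha => hg a (Finset.mem_range.1 ha)

end RCEval

end FK

end Summit.CriticalPhenomena.PercolationContinuityZ3.Theorems
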